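import Summits.AtomisticToContinuum.Crystallization.Theses.ChessboardParticlePlanes
import Summits.AtomisticToContinuum.Crystallization.Theorems.ChessboardParticlePlanesLjPlaneChessboardSliceSwap

/-!
# Crux `ChessboardParticlePlanes.LjPlaneChessboard` (stmt-AtomisticToContinuum-6709), line `Sketch`,
# stub `kernelEntry_regular` — the kernel entries `k_{i₀ m}` are continuous with cubic decay

The per-site chessboard deficit is a planar matrix-kernel lattice form (`deficitSite_kernelForm`)
with entries `k_{i₀ m}(ρ) = Σ_{j ∈ ℤ} T(ρ, j)`, `T = A - B - C - D`: the cross-plane terms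
`A = 2 V_LJ(√(‖ρ - jδ‖² + (z i₀ - z (m + jn))²))` (`m + jn ≠ i₀`) minus the self-copy correction `B`
(on `m + jn = i₀`) and the partner-register corrections `C`, `D` (on `m + jn = i₀ ± 1`), themselves
series over `k` of kernel terms with vertical offsets `2|k|c`, `2|k|c'`, `|2k+1|c`, `|2k+1|c'`
(`c, c' ≥ 3/4` the two gaps at `i₀`).  CLAIM (the input of the Poisson positivity
`matrixLatticeFormNonneg`): `Σ_j |T(ρ, j)| < ∞`, `ρ ↦ Σ_j T(ρ, j)` is continuous, and
`|Σ_j T(ρ, j)| ≤ C (1 + ‖ρ‖)⁻³`.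

PROOF (Weierstrass M-test).  One kernel term `V_LJ(R)`, `R = √(‖ρ - v‖² + b²)` with `|b| ≥ 3/4`
and `‖v‖ ≤ M|b|`, is continuous in `ρ` (`R ≥ |b| > 0`) and satisfies
`|V_LJ(R)| ≤ C₀ R⁻⁶ ≤ C₀ · 64(M+1)³ · |b|⁻³ · (1 + ‖ρ‖)⁻³`, because `R ≥ |b|` and
`4(M+1) R ≥ (4/3)|b| + ‖ρ - v‖ + M|b| ≥ 1 + ‖ρ‖`.  The gap hypothesis makes `z` `3/4`-expanding,
`|z p - z q| ≥ (3/4)|p - q|`, and `|i₀ - m - jn| ≥ |j|` for `i₀, m < n`, so the offsets of `A`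
satisfy `|b_j| ≥ (3/4) max(1, |j|)` and `‖jδ‖ ≤ (4/3)‖δ‖ |b_j|`: the majorants `|b_j|⁻³ ≲ |j|⁻³`
are summable.  The corrections are handled by the same M-test in `k` (`Σ_{k ≠ 0} |k|⁻³`,
`Σ_k |2k+1|⁻³ < ∞`) and are supported on at most one `j` each (`j ↦ m + jn` is injective).
Summing the four majorants, `|T(ρ, j)| ≤ u_j (1 + ‖ρ‖)⁻³` with `Σ u < ∞` and `T(·, j)`
continuous, whence the three claims (`continuous_tsum`, `norm_tsum_le_tsum_norm`).  [folklore]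
No definition is introduced.
-/

noncomputable section

namespace Summit.AtomisticToContinuum.Crystallization.Theorems.ChessboardParticlePlanesLjPlaneChessboard

open Literature.MathematicalPhysics.StatisticalMechanics

/-- **M-test package.**  If `g i : ℝ² → ℝ` are continuous with `|g i ρ| ≤ u i · (1 + ‖ρ‖)⁻³` and
`Σ u < ∞`, then `Σ_i |g i ρ| < ∞`, `ρ ↦ Σ'_i g i ρ` is continuous, and
`|Σ'_i g i ρ| ≤ (Σ' u) (1 + ‖ρ‖)⁻³` (`continuous_tsum`, `norm_tsum_le_tsum_norm`). [folklore] -/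
theorem kernelEntry_mtest {ι : Type*} {g : ι → EuclideanSpace ℝ (Fin 2) → ℝ} {u : ι → ℝ}
    (hg : ∀ i, Continuous (g i)) (hu : Summable u)
    (hle : ∀ i ρ, |g i ρ| ≤ u i * (1 + ‖ρ‖) ^ (-(3 : ℝ))) :
    (∀ ρ, Summable fun i => |g i ρ|) ∧ Continuous (fun ρ => ∑' i, g i ρ) ∧
      ∃ C : ℝ, ∀ ρ, |∑' i, g i ρ| ≤ C * (1 + ‖ρ‖) ^ (-(3 : ℝ)) := by
  have h1 : ∀ ρ : EuclideanSpace ℝ (Fin 2), (1 + ‖ρ‖) ^ (-(3 : ℝ)) ≤ 1 := fun ρ =>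
    Real.rpow_le_one_of_one_le_of_nonpos (by linarith [norm_nonneg ρ]) (by norm_num)
  have hu0 : ∀ i, 0 ≤ u i := fun i => by
    have h := hle i 0
    rw [norm_zero, add_zero, Real.one_rpow, mul_one] at h
    exact (abs_nonneg _).trans h
  have hle' : ∀ i ρ, ‖g i ρ‖ ≤ u i := fun i ρ => by
    rw [Real.norm_eq_abs]
    exact (hle i ρ).trans (mul_le_of_le_one_right (hu0 i) (h1 ρ))
  have hs : ∀ ρ, Summable fun i => |g i ρ| := fun ρ =>
    (Summable.of_norm_bounded hu fun i => hle' i ρ).abs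
  refine ⟨hs, continuous_tsum hg hu hle', ∑' i, u i, fun ρ => ?_⟩
  calc |∑' i, g i ρ| ≤ ∑' i, |g i ρ| := by
        have h := norm_tsum_le_tsum_norm (f := fun i => g i ρ)
          (by simpa only [Real.norm_eq_abs] using hs ρ)
        simpa only [Real.norm_eq_abs] using h
    _ ≤ ∑' i, u i * (1 + ‖ρ‖) ^ (-(3 : ℝ)) :=
        Summable.tsum_le_tsum (fun i => hle i ρ) (hs ρ) (hu.mul_right _)
    _ = (∑' i, u i) * (1 + ‖ρ‖) ^ (-(3 : ℝ)) := tsum_mul_right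

/-- A single kernel term `ρ ↦ V_LJ(√(‖ρ - v‖² + b²))`, `b ≠ 0`, is continuous (the radius stays
`≥ |b| > 0`). [folklore] -/
theorem kernelEntry_term_continuous (v : EuclideanSpace ℝ (Fin 2)) {b : ℝ} (hb : b ≠ 0) :
    Continuous fun ρ : EuclideanSpace ℝ (Fin 2) =>
      lennardJones (Real.sqrt (‖ρ - v‖ ^ 2 + b ^ 2)) := by
  have hR : ∀ ρ : EuclideanSpace ℝ (Fin 2), Real.sqrt (‖ρ - v‖ ^ 2 + b ^ 2) ≠ 0 := fun ρ =>
    (Real.sqrt_pos.2 (by positivity)).ne'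
  have hc : Continuous fun ρ : EuclideanSpace ℝ (Fin 2) =>
      (Real.sqrt (‖ρ - v‖ ^ 2 + b ^ 2))⁻¹ :=
    (((continuous_norm.comp (continuous_id.sub continuous_const)).pow 2).add
      continuous_const).sqrt.inv₀ hR
  unfold lennardJones
  exact (continuous_const.mul (hc.pow 12)).sub (continuous_const.mul (hc.pow 6))

/-- **Decay of one kernel term.**  For `|b| ≥ 3/4` and `‖v‖ ≤ M|b|`:
`|V_LJ(√(‖ρ - v‖² + b²))| ≤ K · |b|⁻³ · (1 + ‖ρ‖)⁻³` with `K = C₀ · 64 (M+1)³`,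
`C₀ = (4/3)⁶/12 + 1/6` (`abs_lennardJones_le`; `R ≥ |b|`, `R ≥ (1 + ‖ρ‖)/(4(M+1))`). [folklore] -/
theorem kernelEntry_term_bound {M : ℝ} (hM : 0 ≤ M) :
    ∃ K : ℝ, 0 ≤ K ∧ ∀ (v : EuclideanSpace ℝ (Fin 2)) (b : ℝ) (ρ : EuclideanSpace ℝ (Fin 2)),
      3 / 4 ≤ |b| → ‖v‖ ≤ M * |b| →
      |lennardJones (Real.sqrt (‖ρ - v‖ ^ 2 + b ^ 2))| ≤
        K * |b|⁻¹ ^ 3 * (1 + ‖ρ‖) ^ (-(3 : ℝ)) := by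
  refine ⟨((3 / 4 : ℝ)⁻¹ ^ 6 / 12 + 1 / 6) * (64 * (M + 1) ^ 3), by positivity,
    fun v b ρ hb hv => ?_⟩
  rw [Real.rpow_neg (by positivity), Real.rpow_ofNat, ← inv_pow]
  set R := Real.sqrt (‖ρ - v‖ ^ 2 + b ^ 2)
  have hb0 : 0 < |b| := by linarith
  have hRb : |b| ≤ R := Real.le_sqrt_of_sq_le (by rw [sq_abs]; nlinarith [sq_nonneg ‖ρ - v‖])
  have hRs : ‖ρ - v‖ ≤ R := Real.le_sqrt_of_sq_le (by nlinarith [sq_nonneg b])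
  have hR0 : 0 < R := hb0.trans_le hRb
  -- the key lower bound `(1 + ‖ρ‖)/(4(M+1)) ≤ R`: `1 + ‖ρ‖ ≤ (4/3)|b| + ‖ρ - v‖ + M|b|`
  have hkey : (1 + ‖ρ‖) / (4 * (M + 1)) ≤ R := by
    rw [div_le_iff₀' (by positivity)]
    nlinarith [norm_sub_norm_le ρ v, mul_le_mul_of_nonneg_left hRb hM]
  have hi1 : R⁻¹ ^ 3 ≤ |b|⁻¹ ^ 3 := pow_le_pow_left₀ (inv_nonneg.2 hR0.le) (inv_anti₀ hb0 hRb) 3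
  have hi2 : R⁻¹ ^ 3 ≤ (64 * (M + 1) ^ 3) * (1 + ‖ρ‖)⁻¹ ^ 3 :=
    calc R⁻¹ ^ 3 ≤ ((1 + ‖ρ‖) / (4 * (M + 1)))⁻¹ ^ 3 :=
          pow_le_pow_left₀ (inv_nonneg.2 hR0.le) (inv_anti₀ (by positivity) hkey) 3
      _ = (64 * (M + 1) ^ 3) * (1 + ‖ρ‖)⁻¹ ^ 3 := by
          rw [inv_div, div_pow, inv_pow, div_eq_mul_inv]; ring
  calc |lennardJones R| ≤ ((3 / 4 : ℝ)⁻¹ ^ 6 / 12 + 1 / 6) * R⁻¹ ^ 6 :=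
        abs_lennardJones_le (by norm_num : (0 : ℝ) < 3 / 4) (hb.trans hRb)
    _ = ((3 / 4 : ℝ)⁻¹ ^ 6 / 12 + 1 / 6) * (R⁻¹ ^ 3 * R⁻¹ ^ 3) := by ring
    _ ≤ ((3 / 4 : ℝ)⁻¹ ^ 6 / 12 + 1 / 6) * ((64 * (M + 1) ^ 3) * (1 + ‖ρ‖)⁻¹ ^ 3 * |b|⁻¹ ^ 3) :=
        mul_le_mul_of_nonneg_left (mul_le_mul hi2 hi1 (by positivity) (by positivity))
          (by positivity)
    _ = _ := by ring

/-- `|a - b - c - d| ≤ |a| + |b| + |c| + |d|`. [folklore] -/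
theorem kernelEntry_abs_sub4_le (a b c d : ℝ) : |a - b - c - d| ≤ |a| + |b| + |c| + |d| := by
  linarith [abs_sub (a - b - c) d, abs_sub (a - b) c, abs_sub a b]

/-- The height sequence is `3/4`-expanding: `(3/4) |p - q| ≤ |z p - z q|` (telescoping the gap
bound). [folklore] -/
theorem kernelEntry_gap_abs {z : ℤ → ℝ} (hgap : ∀ i : ℤ, (3 : ℝ) / 4 ≤ z (i + 1) - z i)
    (p q : ℤ) : (3 : ℝ) / 4 * |((p - q : ℤ) : ℝ)| ≤ |z p - z q| := by
  wlog hpq : q ≤ p generalizing p q with H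
  · have h := H q p (not_le.mp hpq).le
    rwa [abs_sub_comm (z q), ← abs_neg, ← Int.cast_neg, neg_sub] at h
  obtain ⟨k, rfl⟩ := Int.le.dest hpq
  have e : (((q + k - q : ℤ)) : ℝ) = k := by push_cast; ring
  rw [e, Nat.abs_cast]
  refine le_trans ?_ (le_abs_self _)
  clear e hpq
  induction k with
  | zero => simp
  | succ k ih =>
    have h := hgap (q + k)
    rw [add_assoc] at h
    push_cast
    linarith

/-- Index counting: for `i₀, m < n`, `|j| ≤ |i₀ - (m + j n)|`. [folklore] -/
theorem kernelEntry_index_abs {n i₀ m : ℕ} (hi₀ : i₀ < n) (hm : m < n) (j : ℤ) :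
    |j| ≤ |(i₀ : ℤ) - ((m : ℤ) + j * n)| := by
  have hi : (i₀ : ℤ) < n := by exact_mod_cast hi₀
  have hm' : (m : ℤ) < n := by exact_mod_cast hm
  have hi0 : (0 : ℤ) ≤ i₀ := Int.natCast_nonneg _
  have hm0 : (0 : ℤ) ≤ m := Int.natCast_nonneg _
  rcases lt_trichotomy j 0 with hj | rfl | hj
  · rw [abs_of_neg hj]
    refine le_abs.2 (Or.inl ?_)
    nlinarith [mul_nonneg (by omega : (0 : ℤ) ≤ -j - 1) (by omega : (0 : ℤ) ≤ (n : ℤ) - 1)]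
  · simp
  · rw [abs_of_pos hj]
    refine le_abs.2 (Or.inr ?_)
    nlinarith [mul_nonneg (by omega : (0 : ℤ) ≤ j - 1) (by omega : (0 : ℤ) ≤ (n : ℤ) - 1)]

/-- `Σ_{j ∈ ℤ} |j|⁻³ < ∞` (the term `j = 0` is `0`). [folklore] -/
theorem kernelEntry_summable_inv_cube : Summable fun j : ℤ => |(j : ℝ)|⁻¹ ^ 3 := by
  refine ((Real.summable_one_div_int_pow.2 (by norm_num : 1 < 3)).abs).congr fun j => ?_
  rw [abs_div, abs_one, abs_pow, one_div, inv_pow]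

/-- A function of `j ∈ ℤ` supported on `{j | m + j n = i}` (at most one point, `n > 0`) is
summable. [folklore] -/
theorem kernelEntry_ite_summable {n : ℕ} (hn : 0 < n) (m i : ℤ) (U : ℤ → ℝ) :
    Summable fun j : ℤ => if m + j * n = i then U j else 0 := by
  refine summable_of_hasFiniteSupport ?_
  have hn' : (n : ℤ) ≠ 0 := by exact_mod_cast hn.ne'
  have hss : ({j : ℤ | m + j * n = i}).Subsingleton := fun j hj j' hj' => by
    simp only [Set.mem_setOf_eq] at hj hj'
    exact mul_right_cancel₀ hn' (by linarith)
  refine hss.finite.subset fun j hj => ?_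
  by_contra h
  exact hj (if_neg h)

/-- Guarding a continuous function with cubic decay by a constant condition. [folklore] -/
theorem kernelEntry_ite_piece {P : Prop} [Decidable P] {f : EuclideanSpace ℝ (Fin 2) → ℝ}
    {U : ℝ} (hf : Continuous f) (hU : ∀ ρ, |f ρ| ≤ U * (1 + ‖ρ‖) ^ (-(3 : ℝ))) :
    Continuous (fun ρ => if P then f ρ else 0) ∧
      ∀ ρ : EuclideanSpace ℝ (Fin 2),
        |(if P then f ρ else 0)| ≤ (if P then U else 0) * (1 + ‖ρ‖) ^ (-(3 : ℝ)) := by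
  by_cases h : P
  · simp only [if_pos h]
    exact ⟨hf, hU⟩
  · simp only [if_neg h, abs_zero, zero_mul, le_refl, implies_true, and_true]
    exact continuous_const

/-- The self-copy correction `Σ'_{k ≠ 0} (V_LJ(√(‖ρ‖² + (2|k|c)²)) + V_LJ(√(‖ρ‖² + (2|k|c')²)))`,
`c, c' ≥ 3/4`, is continuous with cubic decay (M-test in `k`, `Σ_{k ≠ 0} |k|⁻³ < ∞`). [folklore] -/
theorem kernelEntry_innerB {c c' : ℝ} (hc : 3 / 4 ≤ c) (hc' : 3 / 4 ≤ c') :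
    Continuous (fun ρ : EuclideanSpace ℝ (Fin 2) => ∑' k : {k : ℤ // k ≠ 0},
        (lennardJones (Real.sqrt (‖ρ‖ ^ 2 + (2 * |(k : ℝ)| * c) ^ 2)) +
         lennardJones (Real.sqrt (‖ρ‖ ^ 2 + (2 * |(k : ℝ)| * c') ^ 2)))) ∧
      ∃ U : ℝ, ∀ ρ : EuclideanSpace ℝ (Fin 2), |∑' k : {k : ℤ // k ≠ 0},
        (lennardJones (Real.sqrt (‖ρ‖ ^ 2 + (2 * |(k : ℝ)| * c) ^ 2)) +
         lennardJones (Real.sqrt (‖ρ‖ ^ 2 + (2 * |(k : ℝ)| * c') ^ 2)))| ≤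
          U * (1 + ‖ρ‖) ^ (-(3 : ℝ)) := by
  obtain ⟨K, hK0, hK⟩ := kernelEntry_term_bound (M := 0) le_rfl
  have hk1 : ∀ k : {k : ℤ // k ≠ 0}, (1 : ℝ) ≤ |(k : ℝ)| := fun k => by
    exact_mod_cast Int.one_le_abs k.2
  have hb' : ∀ (k : {k : ℤ // k ≠ 0}) {d : ℝ}, 3 / 4 ≤ d → |(k : ℝ)| ≤ |2 * |(k : ℝ)| * d| :=
    fun k d hd => by
      rw [abs_of_nonneg (by positivity : (0 : ℝ) ≤ 2 * |(k : ℝ)| * d)]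
      nlinarith [hk1 k]
  have hb : ∀ (k : {k : ℤ // k ≠ 0}) {d : ℝ}, 3 / 4 ≤ d → 3 / 4 ≤ |2 * |(k : ℝ)| * d| :=
    fun k d hd => by linarith [hk1 k, hb' k hd]
  have hinv : ∀ (k : {k : ℤ // k ≠ 0}) {d : ℝ}, 3 / 4 ≤ d →
      |2 * |(k : ℝ)| * d|⁻¹ ^ 3 ≤ |(k : ℝ)|⁻¹ ^ 3 := fun k d hd =>
    pow_le_pow_left₀ (inv_nonneg.2 (abs_nonneg _)) (inv_anti₀ (by linarith [hk1 k]) (hb' k hd)) 3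
  have hne : ∀ (k : {k : ℤ // k ≠ 0}) {d : ℝ}, 3 / 4 ≤ d → 2 * |(k : ℝ)| * d ≠ 0 :=
    fun k d hd => abs_pos.1 ((hb k hd).trans_lt' (by norm_num))
  refine (kernelEntry_mtest
    (g := fun (k : {k : ℤ // k ≠ 0}) (ρ : EuclideanSpace ℝ (Fin 2)) =>
      lennardJones (Real.sqrt (‖ρ‖ ^ 2 + (2 * |(k : ℝ)| * c) ^ 2)) +
      lennardJones (Real.sqrt (‖ρ‖ ^ 2 + (2 * |(k : ℝ)| * c') ^ 2)))
    (u := fun k => K * (|2 * |(k : ℝ)| * c|⁻¹ ^ 3 + |2 * |(k : ℝ)| * c'|⁻¹ ^ 3))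
    (fun k => ?_) ?_ fun k ρ => ?_).2
  · have h1 := kernelEntry_term_continuous 0 (hne k hc)
    have h2 := kernelEntry_term_continuous 0 (hne k hc')
    simp only [sub_zero] at h1 h2
    exact h1.add h2
  · refine Summable.of_nonneg_of_le (fun k => by positivity) (fun k => ?_)
      (((kernelEntry_summable_inv_cube.subtype _).add
        (kernelEntry_summable_inv_cube.subtype _)).mul_left K)
    simp only [Function.comp_apply]
    exact mul_le_mul_of_nonneg_left (add_le_add (hinv k hc) (hinv k hc')) hK0
  · have h1 := hK 0 (2 * |(k : ℝ)| * c) ρ (hb k hc) (by simp)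
    have h2 := hK 0 (2 * |(k : ℝ)| * c') ρ (hb k hc') (by simp)
    rw [sub_zero] at h1 h2
    refine (abs_add_le _ _).trans ?_
    nlinarith [h1, h2]

/-- The partner-register correction `Σ'_k V_LJ(√(‖ρ - v‖² + (|2k+1| d)²))`, `d ≥ 3/4`, is
continuous with cubic decay (M-test in `k`, `Σ_k |2k+1|⁻³ < ∞`). [folklore] -/
theorem kernelEntry_innerCD (v : EuclideanSpace ℝ (Fin 2)) {d : ℝ} (hd : 3 / 4 ≤ d) :
    Continuous (fun ρ : EuclideanSpace ℝ (Fin 2) => ∑' k : ℤ,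
        lennardJones (Real.sqrt (‖ρ - v‖ ^ 2 + (|2 * (k : ℝ) + 1| * d) ^ 2))) ∧
      ∃ U : ℝ, ∀ ρ : EuclideanSpace ℝ (Fin 2), |∑' k : ℤ,
        lennardJones (Real.sqrt (‖ρ - v‖ ^ 2 + (|2 * (k : ℝ) + 1| * d) ^ 2))| ≤
          U * (1 + ‖ρ‖) ^ (-(3 : ℝ)) := by
  obtain ⟨K, hK0, hK⟩ := kernelEntry_term_bound (M := 4 / 3 * ‖v‖) (by positivity)
  have hk1 : ∀ k : ℤ, (1 : ℝ) ≤ |2 * (k : ℝ) + 1| := fun k => by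
    exact_mod_cast (Int.one_le_abs (by omega) : (1 : ℤ) ≤ |2 * k + 1|)
  have hb' : ∀ k : ℤ, 3 / 4 * |2 * (k : ℝ) + 1| ≤ |(|2 * (k : ℝ) + 1| * d)| := fun k => by
    rw [abs_of_nonneg (by positivity : (0 : ℝ) ≤ |2 * (k : ℝ) + 1| * d)]
    nlinarith [hk1 k]
  have hb : ∀ k : ℤ, 3 / 4 ≤ |(|2 * (k : ℝ) + 1| * d)| := fun k => by nlinarith [hk1 k, hb' k]
  have hv : ∀ k : ℤ, ‖v‖ ≤ 4 / 3 * ‖v‖ * |(|2 * (k : ℝ) + 1| * d)| := fun k => by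
    nlinarith [norm_nonneg v, hb k]
  have hinv : ∀ k : ℤ, |(|2 * (k : ℝ) + 1| * d)|⁻¹ ^ 3 ≤
      (4 / 3) ^ 3 * |((2 * k + 1 : ℤ) : ℝ)|⁻¹ ^ 3 := fun k => by
    refine (pow_le_pow_left₀ (inv_nonneg.2 (abs_nonneg _))
      (inv_anti₀ (by linarith [hk1 k]) (hb' k)) 3).trans (le_of_eq ?_)
    push_cast
    rw [mul_inv, mul_pow]
    norm_num
  have hinj : Function.Injective fun k : ℤ => 2 * k + 1 := fun k k' h => by simp only at h; omega
  refine (kernelEntry_mtest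
    (g := fun (k : ℤ) (ρ : EuclideanSpace ℝ (Fin 2)) =>
      lennardJones (Real.sqrt (‖ρ - v‖ ^ 2 + (|2 * (k : ℝ) + 1| * d) ^ 2)))
    (u := fun k => K * |(|2 * (k : ℝ) + 1| * d)|⁻¹ ^ 3) (fun k => ?_) ?_ fun k ρ => ?_).2
  · exact kernelEntry_term_continuous v (abs_pos.1 ((hb k).trans_lt' (by norm_num)))
  · refine Summable.of_nonneg_of_le (fun k => by positivity) (fun k => ?_)
      (((kernelEntry_summable_inv_cube.comp_injective hinj).mul_left ((4 / 3) ^ 3)).mul_left K)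
    simp only [Function.comp_apply]
    exact mul_le_mul_of_nonneg_left (hinv k) hK0
  · exact hK v _ ρ (hb k) (hv k)

/-- **Piece A** (the cross-plane terms): summable majorants `u_j = 2K |z i₀ - z (m + jn)|⁻³`
(`≲ |j|⁻³` off `j = 0`), continuity, cubic decay. [folklore] -/
theorem kernelEntry_pieceA (z : ℤ → ℝ) (n : ℕ) (δ : EuclideanSpace ℝ (Fin 2)) (i₀ m : ℕ)
    (hgap : ∀ i : ℤ, (3 : ℝ) / 4 ≤ z (i + 1) - z i) (hi₀ : i₀ < n) (hm : m < n) :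
    ∃ u : ℤ → ℝ, Summable u ∧ ∀ j : ℤ,
      Continuous (fun ρ : EuclideanSpace ℝ (Fin 2) =>
        (if (m : ℤ) + j * n = (i₀ : ℤ) then 0 else
          2 * lennardJones (Real.sqrt (‖ρ - (j : ℝ) • δ‖ ^ 2 +
            (z (i₀ : ℤ) - z ((m : ℤ) + j * n)) ^ 2)))) ∧
      ∀ ρ : EuclideanSpace ℝ (Fin 2),
        |(if (m : ℤ) + j * n = (i₀ : ℤ) then 0 else
          2 * lennardJones (Real.sqrt (‖ρ - (j : ℝ) • δ‖ ^ 2 +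
            (z (i₀ : ℤ) - z ((m : ℤ) + j * n)) ^ 2)))| ≤ u j * (1 + ‖ρ‖) ^ (-(3 : ℝ)) := by
  obtain ⟨K, hK0, hK⟩ := kernelEntry_term_bound (M := 4 / 3 * ‖δ‖) (by positivity)
  have hZ : ∀ j : ℤ, 3 / 4 * |(((i₀ : ℤ) - ((m : ℤ) + j * n) : ℤ) : ℝ)| ≤
      |z i₀ - z ((m : ℤ) + j * n)| := fun j => kernelEntry_gap_abs hgap _ _
  have hoff : ∀ j : ℤ, 3 / 4 * |(j : ℝ)| ≤ |z i₀ - z ((m : ℤ) + j * n)| := fun j => by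
    have h2 : |(j : ℝ)| ≤ |(((i₀ : ℤ) - ((m : ℤ) + j * n) : ℤ) : ℝ)| := by
      exact_mod_cast kernelEntry_index_abs hi₀ hm j
    linarith [hZ j]
  have hoff' : ∀ j : ℤ, (m : ℤ) + j * n ≠ i₀ → 3 / 4 ≤ |z i₀ - z ((m : ℤ) + j * n)| :=
    fun j hj => by
      have h2 : (1 : ℝ) ≤ |(((i₀ : ℤ) - ((m : ℤ) + j * n) : ℤ) : ℝ)| := by
        exact_mod_cast Int.one_le_abs (sub_ne_zero.2 (Ne.symm hj))
      nlinarith [hZ j]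
  refine ⟨fun j => 2 * K * |z i₀ - z ((m : ℤ) + j * n)|⁻¹ ^ 3, ?_, fun j => ⟨?_, fun ρ => ?_⟩⟩
  · -- summability: off `j = 0` the majorant is `≤ 2K (4/3)³ |j|⁻³`
    refine Summable.of_norm_bounded_eventually
      (kernelEntry_summable_inv_cube.mul_left (2 * K * (4 / 3) ^ 3)) ?_
    refine Filter.eventually_cofinite.2 ((Set.finite_singleton (0 : ℤ)).subset fun j hj => ?_)
    by_contra hj0
    apply hj
    have hjpos : 0 < |(j : ℝ)| := abs_pos.2 (by exact_mod_cast hj0)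
    rw [Real.norm_of_nonneg (by positivity)]
    have h := pow_le_pow_left₀ (inv_nonneg.2 (abs_nonneg _))
      (inv_anti₀ (by positivity) (hoff j)) 3
    calc 2 * K * |z i₀ - z ((m : ℤ) + j * n)|⁻¹ ^ 3 ≤ 2 * K * (3 / 4 * |(j : ℝ)|)⁻¹ ^ 3 :=
          mul_le_mul_of_nonneg_left h (by positivity)
      _ = 2 * K * (4 / 3) ^ 3 * |(j : ℝ)|⁻¹ ^ 3 := by rw [mul_inv, mul_pow]; norm_num; ring
  · by_cases h : (m : ℤ) + j * n = i₀
    · simpa only [if_pos h] using continuous_const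
    · simp only [if_neg h]
      exact continuous_const.mul
        (kernelEntry_term_continuous _ (abs_pos.1 ((hoff' j h).trans_lt' (by norm_num))))
  · by_cases h : (m : ℤ) + j * n = i₀
    · simp only [if_pos h, abs_zero]; positivity
    · simp only [if_neg h]
      have hv : ‖(j : ℝ) • δ‖ ≤ 4 / 3 * ‖δ‖ * |z i₀ - z ((m : ℤ) + j * n)| := by
        rw [norm_smul, Real.norm_eq_abs]
        nlinarith [hoff j, norm_nonneg δ, abs_nonneg (j : ℝ)]
      have h1 := hK ((j : ℝ) • δ) _ ρ (hoff' j h) hv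
      rw [abs_mul, abs_two]
      nlinarith [h1]

/-- **K1 — the kernel entry `k_{i₀ m}` is a well-defined continuous function with cubic decay**:
for a `3/4`-gapped height sequence `z`, a planar shift `δ` and `i₀, m < n`, the series `Σ_j T(ρ, j)`
converges absolutely, its sum is continuous in `ρ`, and `|Σ_j T(ρ, j)| ≤ C (1 + ‖ρ‖)⁻³`
(`StrictMono z`, `0 < c₀` and the vertical period are not used). [folklore] -/
theorem kernelEntry_regular :
    ∀ (z : ℤ → ℝ) (n : ℕ) (δ : EuclideanSpace ℝ (Fin 2)) (c₀ : ℝ) (i₀ m : ℕ),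
      0 < n → StrictMono z → (∀ i : ℤ, (3 : ℝ) / 4 ≤ z (i + 1) - z i) → 0 < c₀ →
      (∀ i : ℤ, z (i + n) = z i + c₀) → i₀ < n → m < n →
      (∀ ρ : EuclideanSpace ℝ (Fin 2), Summable (fun j : ℤ =>
        |(if (m : ℤ) + j * n = (i₀ : ℤ) then 0 else
            2 * lennardJones (Real.sqrt (‖ρ - (j : ℝ) • δ‖ ^ 2 + (z (i₀ : ℤ) - z ((m : ℤ) + j * n)) ^ 2)))
          - (if (m : ℤ) + j * n = (i₀ : ℤ) then
              ∑' k : {k : ℤ // k ≠ 0},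
                (lennardJones (Real.sqrt (‖ρ‖ ^ 2 + (2 * |(k : ℝ)| * (z ((i₀ : ℤ) + 1) - z (i₀ : ℤ))) ^ 2)) +
                 lennardJones (Real.sqrt (‖ρ‖ ^ 2 + (2 * |(k : ℝ)| * (z (i₀ : ℤ) - z ((i₀ : ℤ) - 1))) ^ 2)))
             else 0)
          - (if (m : ℤ) + j * n = (i₀ : ℤ) + 1 then
              ∑' k : ℤ, lennardJones (Real.sqrt (‖ρ - (j : ℝ) • δ‖ ^ 2
                + (|2 * (k : ℝ) + 1| * (z ((i₀ : ℤ) + 1) - z (i₀ : ℤ))) ^ 2))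
             else 0)
          - (if (m : ℤ) + j * n = (i₀ : ℤ) - 1 then
              ∑' k : ℤ, lennardJones (Real.sqrt (‖ρ - (j : ℝ) • δ‖ ^ 2
                + (|2 * (k : ℝ) + 1| * (z (i₀ : ℤ) - z ((i₀ : ℤ) - 1))) ^ 2))
             else 0)|)) ∧
      Continuous (fun ρ : EuclideanSpace ℝ (Fin 2) => ∑' j : ℤ,
        ((if (m : ℤ) + j * n = (i₀ : ℤ) then 0 else
            2 * lennardJones (Real.sqrt (‖ρ - (j : ℝ) • δ‖ ^ 2 + (z (i₀ : ℤ) - z ((m : ℤ) + j * n)) ^ 2)))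
          - (if (m : ℤ) + j * n = (i₀ : ℤ) then
              ∑' k : {k : ℤ // k ≠ 0},
                (lennardJones (Real.sqrt (‖ρ‖ ^ 2 + (2 * |(k : ℝ)| * (z ((i₀ : ℤ) + 1) - z (i₀ : ℤ))) ^ 2)) +
                 lennardJones (Real.sqrt (‖ρ‖ ^ 2 + (2 * |(k : ℝ)| * (z (i₀ : ℤ) - z ((i₀ : ℤ) - 1))) ^ 2)))
             else 0)
          - (if (m : ℤ) + j * n = (i₀ : ℤ) + 1 then
              ∑' k : ℤ, lennardJones (Real.sqrt (‖ρ - (j : ℝ) • δ‖ ^ 2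
                + (|2 * (k : ℝ) + 1| * (z ((i₀ : ℤ) + 1) - z (i₀ : ℤ))) ^ 2))
             else 0)
          - (if (m : ℤ) + j * n = (i₀ : ℤ) - 1 then
              ∑' k : ℤ, lennardJones (Real.sqrt (‖ρ - (j : ℝ) • δ‖ ^ 2
                + (|2 * (k : ℝ) + 1| * (z (i₀ : ℤ) - z ((i₀ : ℤ) - 1))) ^ 2))
             else 0))) ∧
      ∃ C : ℝ, ∀ ρ : EuclideanSpace ℝ (Fin 2), |∑' j : ℤ,
        ((if (m : ℤ) + j * n = (i₀ : ℤ) then 0 else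
            2 * lennardJones (Real.sqrt (‖ρ - (j : ℝ) • δ‖ ^ 2 + (z (i₀ : ℤ) - z ((m : ℤ) + j * n)) ^ 2)))
          - (if (m : ℤ) + j * n = (i₀ : ℤ) then
              ∑' k : {k : ℤ // k ≠ 0},
                (lennardJones (Real.sqrt (‖ρ‖ ^ 2 + (2 * |(k : ℝ)| * (z ((i₀ : ℤ) + 1) - z (i₀ : ℤ))) ^ 2)) +
                 lennardJones (Real.sqrt (‖ρ‖ ^ 2 + (2 * |(k : ℝ)| * (z (i₀ : ℤ) - z ((i₀ : ℤ) - 1))) ^ 2)))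
             else 0)
          - (if (m : ℤ) + j * n = (i₀ : ℤ) + 1 then
              ∑' k : ℤ, lennardJones (Real.sqrt (‖ρ - (j : ℝ) • δ‖ ^ 2
                + (|2 * (k : ℝ) + 1| * (z ((i₀ : ℤ) + 1) - z (i₀ : ℤ))) ^ 2))
             else 0)
          - (if (m : ℤ) + j * n = (i₀ : ℤ) - 1 then
              ∑' k : ℤ, lennardJones (Real.sqrt (‖ρ - (j : ℝ) • δ‖ ^ 2
                + (|2 * (k : ℝ) + 1| * (z (i₀ : ℤ) - z ((i₀ : ℤ) - 1))) ^ 2))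
             else 0))| ≤ C * (1 + ‖ρ‖) ^ (-(3 : ℝ)) := by
  intro z n δ c₀ i₀ m hn _hz hgap _hc₀ _hper hi₀ hm
  have hc : (3 : ℝ) / 4 ≤ z ((i₀ : ℤ) + 1) - z (i₀ : ℤ) := hgap _
  have hc' : (3 : ℝ) / 4 ≤ z (i₀ : ℤ) - z ((i₀ : ℤ) - 1) := by simpa using hgap ((i₀ : ℤ) - 1)
  obtain ⟨uA, hA, hA'⟩ := kernelEntry_pieceA z n δ i₀ m hgap hi₀ hm
  obtain ⟨hUB, UB, hUB'⟩ := kernelEntry_innerB hc hc'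
  choose UC hUC using fun j : ℤ => (kernelEntry_innerCD ((j : ℝ) • δ) hc).2
  choose UD hUD using fun j : ℤ => (kernelEntry_innerCD ((j : ℝ) • δ) hc').2
  have hB := fun j : ℤ => kernelEntry_ite_piece (P := (m : ℤ) + j * n = (i₀ : ℤ)) hUB hUB'
  have hC := fun j : ℤ => kernelEntry_ite_piece (P := (m : ℤ) + j * n = (i₀ : ℤ) + 1)
    (kernelEntry_innerCD ((j : ℝ) • δ) hc).1 (hUC j)
  have hD := fun j : ℤ => kernelEntry_ite_piece (P := (m : ℤ) + j * n = (i₀ : ℤ) - 1)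
    (kernelEntry_innerCD ((j : ℝ) • δ) hc').1 (hUD j)
  refine kernelEntry_mtest
    (u := fun j => uA j + (if (m : ℤ) + j * n = (i₀ : ℤ) then UB else 0) +
      (if (m : ℤ) + j * n = (i₀ : ℤ) + 1 then UC j else 0) +
      (if (m : ℤ) + j * n = (i₀ : ℤ) - 1 then UD j else 0))
    (fun j => (((hA' j).1.sub (hB j).1).sub (hC j).1).sub (hD j).1)
    (((hA.add (kernelEntry_ite_summable hn _ _ _)).add (kernelEntry_ite_summable hn _ _ _)).add
      (kernelEntry_ite_summable hn _ _ _)) fun j ρ => ?_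
  refine (kernelEntry_abs_sub4_le _ _ _ _).trans ?_
  linarith [(hA' j).2 ρ, (hB j).2 ρ, (hC j).2 ρ, (hD j).2 ρ]

end Summit.AtomisticToContinuum.Crystallization.Theorems.ChessboardParticlePlanesLjPlaneChessboard

end
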